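import Summits.HodgeConjecture.HodgeConjecture.Theorems.R90S6LatticeInvCalculus          -- L1 FILE 1: `relPos` and its calculus (brings ★ W7-f (i)(ii), ★ CartanUnique, the `Valued`∕`ValuativeRel` bridge)
import Summits.HodgeConjecture.HodgeConjecture.Theorems.R90S6TwistedPolarity             -- ★ W9-b `mapGL_qsInvolution_stdLattice` (`Θ_σ(g)·𝒪^N = (g·𝒪^N)^♯`, R90-C14-p03)
import Literature.NumberTheory.Automorphic.UnitaryGroupCongruenceIwahoriFactorisation    -- ★ `UnitaryGroup.coe_qsInvolution_apply` (`Θ_σ(g) i j = σ (g⁻¹ (rev j) (rev i))`)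
import HarnessLib

/-!
# R90 · S6 «Ch. 14.1–14.5 stable TF» — card L1 (row E1.4.4.2.2, layer 1), FILE 2: THE RELATIVE POSITION UNDER THE POLARITY
# `Θ_σ(GL_N(𝒪)) = GL_N(𝒪)`, `Θ_σ(ϖ^a) = ϖ^{−w₀a}`, **`inv(Λ^♯, Λ′^♯) = −w₀·inv(Λ, Λ′)`**, and «`Λ^♯ = ϖ^c·Λ ⟺ inv(Λ, Λ^♯) = (c, …, c)`» (`Theorems/R90S6LatticeInvPolarity.lean`)

Cell `hodgecm-mathlib`, crux H413 (`stmt-HodgeConjecture-24833`), route `HCCMUnconditional`; programme R90-TF, section S6 (base `R90-C14`, dealer R90-C14-plan (g2)), seat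
R90-C14-p10 (g0); card **L1** (DEAL 2026-09-05T00:12:58Z l.6040, «=» on the cut 00:15:57Z l.6140), heads (10)–(13) of the L1 sheet.  Lane `--kind proof --supports stmt-HodgeConjecture-24833`
(helper; THEOREMS ONLY: no definition, no instance, no notation, no named fact, no `sorry`).  Imports: L1 FILE 1 `Theorems.R90S6LatticeInvCalculus` (`relPos`) + ★ p03 W9-b
`Theorems.R90S6TwistedPolarity` + ★ `Literature…UnitaryGroupCongruenceIwahoriFactorisation` (entries of `Θ_σ`) + HarnessLib; no `Cruxes` import.

THE MATHEMATICS (Kottwitz 1986 §1, §3; Rogawski 1990 §1.9–§1.10; Macdonald V §2).  `Θ_σ(g) = w⁰ ᵗ(σg)⁻¹ w⁰` (★ `UnitaryGroup.qsInvolution`) is the automorphism of `GL_N(K)` whose fixed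
points are `U(σ, J₀)`; on lattices it IS the polarity: `Θ_σ(g)·𝒪^N = (g·𝒪^N)^♯` (★ W9-b).  For `σ` preserving the valuation and fixing the uniformizer `ϖ`:
* §1 `qsInvolution_one` ∕ `qsInvolution_inv` (bookkeeping: `Θ_σ` is a group endomorphism); **`qsInvolution_mem_glInt`**: `Θ_σ(GL_N(𝒪)) ⊆ GL_N(𝒪)` (entries of `Θ_σ(k)` are `σ` of
  entries of `k⁻¹`, ★ `coe_qsInvolution_apply`); **`qsInvolution_zpowDiagGL`**: `Θ_σ(ϖ^a) = ϖ^{−w₀a}`, `(−w₀a)_i = −a_{rev i}`;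
* §2 **`relPos_qsInvolution`: `inv(Θ_σ g, Θ_σ g′) = −w₀·inv(g, g′)`** (apply `Θ_σ` to the Cartan shell `k₁ (g⁻¹g′) k₂ = ϖ^a`), whence with ★ W9-b **`relPos_qsInvolution_eq_relPos_swap`**:
  `inv(Λ^♯, Λ′^♯) = inv(Λ′, Λ)` (polarity = swap, both `−w₀`; FILE 1 `relPos_swap`);
* §3 the «distance to the unitary tree» `d(Λ) := inv(Λ, Λ^♯) = relPos hϖ g (Θ_σ g)`: `relPos_qsInvolution_self` (`inv(Λ^♯, Λ) = −w₀·d(Λ)`, recorded) and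
  **`relPos_self_qsInvolution_eq_const_iff`**: `d(Λ) = (c, …, c) ⟺ Λ^♯ = (g ϖ^c)·𝒪^N` — SELF-DUAL UP TO THE HOMOTHETY `ϖ^c` (`c = 0`: `Λ` self-dual, the hyperspecial vertices; ★ W9-b for
  `Λ^♯ = Θ_σ(g)·𝒪^N`, ★ W7-f (i) for the coset reading).
The parity law `Σ_i d_i ≡ 0 (2)` (head (14)) is the sequel FILE 3 (it needs the `ℤ`-exponent determinant bookkeeping in `Valued` currency).
HONEST LABEL: lattice bookkeeping; proves no printed global statement, discharges no citation; count-neutral helper until E1.4.4.2.1–.2.3 consume it.  HC_CM is proved only modulo the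
7 printed citations (2 remaining named inputs: hLiu418 = stmt-HodgeConjecture-24832, h413 = stmt-HodgeConjecture-24833) until rung 0 closes.

## References
* [Kottwitz1986BaseChangeUnits] R. Kottwitz, *Base change for unit elements of Hecke algebras*, Compositio Math. 60 (1986), §1 pp. 239–242, §3 (lattices, `X_E`, the involution).
* [Rogawski1990] J. D. Rogawski, *Automorphic Representations of Unitary Groups in Three Variables*, Ann. of Math. Stud. 123 (1990), §1.9–§1.10 pp. 8–9 (`Θ`, `w⁰`).
* [Macdonald1995] I. G. Macdonald, *Symmetric Functions and Hall Polynomials*, 2nd ed. (1995), Ch. V §2 (2.2), (2.6).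
-/
set_option autoImplicit false
-- the mandated namespace repeats the single-problem summit's segment (`HodgeConjecture.HodgeConjecture`)
set_option linter.dupNamespace false

noncomputable section

open scoped Matrix MatrixGroups Valued WithZero
open Literature.NumberTheory.Automorphic Literature.NumberTheory.Automorphic.HermitianLattice Literature.NumberTheory.Automorphic.UnitaryLatticeTree

namespace Summit.HodgeConjecture.HodgeConjecture.R90.S6

/-! ## §1 `Θ_σ` on `GL_N(𝒪)` and on the torus -/

section Theta

variable {K : Type*} [Field K] {σ : K →+* K} {N : ℕ}

/-- `Θ_σ(1) = 1` (from multiplicativity ★ `qsInvolution_mul`). [cite: Rogawski1990, §1.9 p. 8] -/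
theorem qsInvolution_one : UnitaryGroup.qsInvolution σ (1 : GL (Fin N) K) = 1 := by
  have h := UnitaryGroup.qsInvolution_mul σ (1 : GL (Fin N) K) 1
  rw [one_mul] at h
  exact mul_eq_left.1 h.symm

/-- `Θ_σ(g⁻¹) = Θ_σ(g)⁻¹`. [cite: Rogawski1990, §1.9 p. 8] -/
theorem qsInvolution_inv (g : GL (Fin N) K) : UnitaryGroup.qsInvolution σ g⁻¹ = (UnitaryGroup.qsInvolution σ g)⁻¹ := by
  refine eq_inv_of_mul_eq_one_left ?_
  rw [← UnitaryGroup.qsInvolution_mul, inv_mul_cancel, qsInvolution_one]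

/-- **`Θ_σ(ϖ^a) = ϖ^{−w₀a}`**: for `σ ϖ = ϖ`, `Θ_σ(diag(ϖ^{a_i})) = diag(ϖ^{−a_{rev i}})` (`w⁰ diag(ϖ^{−a}) w⁰`). [cite: Rogawski1990, §1.10 p. 9] [cite: BruhatTits1972, (4.4.3)] -/
theorem qsInvolution_zpowDiagGL {ϖ : K} (hϖ0 : ϖ ≠ 0) (hσϖ : σ ϖ = ϖ) (a : Fin N → ℤ) :
    UnitaryGroup.qsInvolution σ (zpowDiagGL hϖ0 a) = zpowDiagGL hϖ0 (fun i => - a (Fin.rev i)) := by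
  refine Matrix.GeneralLinearGroup.ext fun i j => ?_
  rw [UnitaryGroup.coe_qsInvolution_apply, ← zpowDiagGL_neg, coe_zpowDiagGL, coe_zpowDiagGL, Matrix.diagonal_apply, Matrix.diagonal_apply]
  by_cases hij : i = j
  · subst hij
    rw [if_pos rfl, if_pos rfl, Pi.neg_apply, map_zpow₀, hσϖ]
  · rw [if_neg (fun h => hij (Fin.rev_injective h).symm), if_neg hij, map_zero]

variable [Valued K ℤᵐ⁰] [ValuativeRel K] [(Valued.v : Valuation K ℤᵐ⁰).Compatible]

/-- **`Θ_σ(GL_N(𝒪)) ⊆ GL_N(𝒪)`** for `σ` preserving the valuation: the entries of `Θ_σ(k)` are `σ` of entries of `k⁻¹` and those of `Θ_σ(k)⁻¹ = Θ_σ(k⁻¹)` are `σ` of entries of `k`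
(★ `coe_qsInvolution_apply`, ★ W7-f (i) `mem_glInt_iff_isIntMatrix`). [cite: Kottwitz1986BaseChangeUnits, §1 p. 240] [cite: Rogawski1990, §1.10 p. 9] -/
theorem qsInvolution_mem_glInt (hvσ : ∀ a, Valued.v (σ a) = Valued.v a) {k : GL (Fin N) K} (hk : k ∈ glInt N K) :
    UnitaryGroup.qsInvolution σ k ∈ glInt N K := by
  rw [mem_glInt_iff_isIntMatrix] at hk ⊢
  refine ⟨fun i j => ?_, fun i j => ?_⟩
  · rw [UnitaryGroup.coe_qsInvolution_apply, hvσ]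
    exact hk.2 _ _
  · rw [← qsInvolution_inv, UnitaryGroup.coe_qsInvolution_apply, inv_inv, hvσ]
    exact hk.1 _ _

end Theta

/-! ## §2 `inv(Θ_σ g, Θ_σ g′) = −w₀·inv(g, g′)`: the polarity reverses and negates the relative position -/

section Polarity

variable {K : Type*} [Field K] [Valued K ℤᵐ⁰] [ValuativeRel K] [(Valued.v : Valuation K ℤᵐ⁰).Compatible] {σ : K →+* K} {N : ℕ}
  [IsDiscreteValuationRing (ValuativeRel.valuation K).integer] {ϖ : K} (hϖ : IsUniformizingElement ϖ)
include hϖ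

/-- **`inv(Θ_σ g, Θ_σ g′) = −w₀·inv(g, g′)`**: `relPos hϖ (Θ_σ g) (Θ_σ g′) = (i ↦ −relPos hϖ g g′ (rev i))` (`σ` valuation-preserving, `σ ϖ = ϖ`): applying the endomorphism `Θ_σ` to the
Cartan shell `k₁ (g⁻¹g′) k₂ = ϖ^a` gives `Θk₁ · (Θg)⁻¹(Θg′) · Θk₂ = ϖ^{−w₀a}` with `Θk_i ∈ GL_N(𝒪)`.  With ★ W9-b (`Θ_σ(g)·𝒪^N = Λ^♯`): **`inv(Λ^♯, Λ′^♯) = −w₀·inv(Λ, Λ′)`**.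
[cite: Kottwitz1986BaseChangeUnits, §3] [cite: Macdonald1995, Ch. V §2 (2.6)] -/
theorem relPos_qsInvolution (hvσ : ∀ a, Valued.v (σ a) = Valued.v a) (hσϖ : σ ϖ = ϖ) (g g' : GL (Fin N) K) :
    relPos hϖ (UnitaryGroup.qsInvolution σ g) (UnitaryGroup.qsInvolution σ g') = fun i => - relPos hϖ g g' (Fin.rev i) := by
  obtain ⟨ha, k₁, hk₁, k₂, hk₂, e⟩ := relPos_spec hϖ g g'
  refine (relPos_eq_iff hϖ _ _ _).2 ⟨fun i j hij => neg_le_neg (ha (Fin.rev_le_rev.2 hij)),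
    UnitaryGroup.qsInvolution σ k₁, qsInvolution_mem_glInt hvσ hk₁, UnitaryGroup.qsInvolution σ k₂, qsInvolution_mem_glInt hvσ hk₂, ?_⟩
  rw [← qsInvolution_zpowDiagGL hϖ.ne_zero hσϖ, ← e, UnitaryGroup.qsInvolution_mul, UnitaryGroup.qsInvolution_mul, UnitaryGroup.qsInvolution_mul, qsInvolution_inv]

/-- **Polarity = swap on relative positions**: `inv(Θ_σ g, Θ_σ g′) = inv(g′, g)` (both are `−w₀·inv(g, g′)`, FILE 1 `relPos_swap`) — in lattice words `inv(Λ^♯, Λ′^♯) = inv(Λ′, Λ)`.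
[cite: Macdonald1995, Ch. V §2 (2.6)] -/
theorem relPos_qsInvolution_eq_relPos_swap (hvσ : ∀ a, Valued.v (σ a) = Valued.v a) (hσϖ : σ ϖ = ϖ) (g g' : GL (Fin N) K) :
    relPos hϖ (UnitaryGroup.qsInvolution σ g) (UnitaryGroup.qsInvolution σ g') = relPos hϖ g' g := by
  rw [relPos_qsInvolution hϖ hvσ hσϖ, relPos_swap hϖ g g']

/-! ## §3 The distance to the unitary tree `d(Λ) = inv(Λ, Λ^♯)` -/

omit [Valued K ℤᵐ⁰] [(Valued.v : Valuation K ℤᵐ⁰).Compatible] in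
/-- **`inv(Λ^♯, Λ) = −w₀·inv(Λ, Λ^♯)`** (FILE 1 `relPos_swap` at the pair `(g, Θ_σ g)`; recorded under the polarity's name for the layer-2 consumers). [cite: Macdonald1995, Ch. V §2 (2.6)] -/
theorem relPos_qsInvolution_self (g : GL (Fin N) K) :
    relPos hϖ (UnitaryGroup.qsInvolution σ g) g = fun i => - relPos hϖ g (UnitaryGroup.qsInvolution σ g) (Fin.rev i) :=
  relPos_swap hϖ g (UnitaryGroup.qsInvolution σ g)

/-- **SELF-DUAL UP TO HOMOTHETY ⟺ CONSTANT DISTANCE**: `inv(Λ, Λ^♯) = (c, …, c) ⟺ Λ^♯ = (g·ϖ^{(c,…,c)})·𝒪^N` for `Λ = g·𝒪^N` (`σ` valuation-preserving; `Λ^♯ = Θ_σ(g)·𝒪^N` by ★ W9-b,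
the shell `GL_N(𝒪) ϖ^{c·1} GL_N(𝒪) = ϖ^c·GL_N(𝒪)` is a single coset since `ϖ^c·1` is central, and cosets are lattices by ★ W7-f (i)); `c = 0`: `Λ` is `J₀`-self-dual, i.e. a hyperspecial vertex.
[cite: Kottwitz1986BaseChangeUnits, §3] [cite: BruhatTits1972, §10] -/
theorem relPos_self_qsInvolution_eq_const_iff (hvσ : ∀ a, Valued.v (σ a) = Valued.v a) (g : GL (Fin N) K) (c : ℤ) :
    relPos hϖ g (UnitaryGroup.qsInvolution σ g) = (fun _ : Fin N => c) ↔
      dualLatt σ ((StdForm.antidiagonal N).over K) (latt (g : Matrix (Fin N) (Fin N) K)) =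
        latt ((g * zpowDiagGL hϖ.ne_zero (fun _ : Fin N => c) : GL (Fin N) K) : Matrix (Fin N) (Fin N) K) := by
  -- `Λ^♯ = Θ_σ(g)·𝒪^N` (★ W9-b, framed)
  have hdual : dualLatt σ ((StdForm.antidiagonal N).over K) (latt (g : Matrix (Fin N) (Fin N) K)) =
      latt ((UnitaryGroup.qsInvolution σ g : GL (Fin N) K) : Matrix (Fin N) (Fin N) K) := by
    have h := mapGL_qsInvolution_stdLattice (N := N) hvσ g
    rw [← latt_one, ← Units.val_one, mapGL_latt, mapGL_latt, mul_one, mul_one] at h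
    exact h.symm
  rw [hdual, latt_eq_latt_iff_mem_glInt, relPos_eq_iff]
  constructor
  · rintro ⟨-, k₁, hk₁, k₂, hk₂, e⟩
    -- `g⁻¹ Θg = k₁⁻¹ Z k₂⁻¹ = Z k₁⁻¹ k₂⁻¹`, so `(Θg)⁻¹ (g Z) = (k₁⁻¹k₂⁻¹)⁻¹ = k₂ k₁`
    have e' : (UnitaryGroup.qsInvolution σ g)⁻¹ * (g * zpowDiagGL hϖ.ne_zero fun _ : Fin N => c) = k₂ * k₁ := by
      have h1 : g⁻¹ * UnitaryGroup.qsInvolution σ g = k₁⁻¹ * zpowDiagGL hϖ.ne_zero (fun _ : Fin N => c) * k₂⁻¹ := by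
        rw [← e]; group
      calc (UnitaryGroup.qsInvolution σ g)⁻¹ * (g * zpowDiagGL hϖ.ne_zero fun _ : Fin N => c)
          = (g⁻¹ * UnitaryGroup.qsInvolution σ g)⁻¹ * zpowDiagGL hϖ.ne_zero (fun _ : Fin N => c) := by group
        _ = (k₁⁻¹ * zpowDiagGL hϖ.ne_zero (fun _ : Fin N => c) * k₂⁻¹)⁻¹ * zpowDiagGL hϖ.ne_zero (fun _ : Fin N => c) := by rw [h1]
        _ = k₂ * ((zpowDiagGL hϖ.ne_zero (fun _ : Fin N => c))⁻¹ * (k₁ * zpowDiagGL hϖ.ne_zero (fun _ : Fin N => c))) := by group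
        _ = k₂ * ((zpowDiagGL hϖ.ne_zero (fun _ : Fin N => c))⁻¹ * (zpowDiagGL hϖ.ne_zero (fun _ : Fin N => c) * k₁)) := by
            rw [mul_zpowDiagGL_const_comm hϖ.ne_zero c k₁]
        _ = k₂ * k₁ := by group
    rw [e']
    exact (glInt N K).mul_mem hk₂ hk₁
  · intro hk
    refine ⟨antitone_const, 1, (glInt N K).one_mem, ((UnitaryGroup.qsInvolution σ g)⁻¹ * (g * zpowDiagGL hϖ.ne_zero fun _ : Fin N => c)), hk, ?_⟩
    calc 1 * (g⁻¹ * UnitaryGroup.qsInvolution σ g) * ((UnitaryGroup.qsInvolution σ g)⁻¹ * (g * zpowDiagGL hϖ.ne_zero fun _ : Fin N => c))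
        = zpowDiagGL hϖ.ne_zero (fun _ : Fin N => c) := by group

end Polarity

end Summit.HodgeConjecture.HodgeConjecture.R90.S6

end
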